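import Literature.Analysis.ODE.LinearComparison
import HarnessLib

/-!
# Hartman's basic inequality for linear growth in norm with a continuous time-dependent modulus
# (Hartman, *Ordinary Differential Equations*, Ch. IV Lemma 4.1, eq. (4.2))

Topic `Literature/Analysis/ODE` (namespace `Literature.Analysis.ODE`). Hartman, Ch. IV §4
("Basic inequalities", held text PDF p. 60), Lemma 4.1: *Let `y = y(t)` be a solution of
`y' = A(t) y + f(t)` and `t, t₀ ∈ [a, b]`. Then*
`|y(t)| ≤ {|y(t₀)| + |∫_{t₀}^t |f(s)| ds|} exp |∫_{t₀}^t ‖A(s)‖ ds|` (4.2);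
the proof uses only "the inequality `|y'| ≤ ‖A(t)‖ |y| + |f(t)|`" and a comparison with the
scalar majorant equation, "interchanging `t` and `t₀`" for `t ≤ t₀`. Typed here, for functions
with values in a real normed space and in the differential-inequality form the proof uses, are
the two pure cases of (4.2):

* `norm_le_mul_exp_integral_of_norm_deriv_right_le` — homogeneous case (`f ≡ 0`), forward on
  `[a, b]` with right derivatives: `‖g'‖ ≤ M(s) ‖g‖` with `M` continuous on `[a, b]` gives
  `‖g(t)‖ ≤ ‖g(a)‖ exp ∫ₐᵗ M`; `norm_le_mul_exp_abs_integral_of_norm_deriv_le_uIcc` — the same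
  between two times `t₀, t` in either order, `‖g(t)‖ ≤ ‖g(t₀)‖ exp |∫_{t₀}^t M|` (time reversal);
* `norm_sub_le_integral_of_norm_deriv_right_le` — the case `A ≡ 0`: `‖g'‖ ≤ N(s)` gives
  `‖g(t) − g(a)‖ ≤ ∫ₐᵗ N`, and `norm_sub_le_abs_integral_of_norm_deriv_le_uIcc` (either order);
* `norm_le_exp_integral_mul_of_norm_deriv_right_le` — the general case `‖g'‖ ≤ M(s) ‖g‖ + N(s)`
  in the sharp form of Hartman's proof (the solution `u⁰` of the majorant equation
  `u' = M u + N`, `u(a) = ‖g(a)‖`): `‖g(t)‖ ≤ e^{P(t)} (‖g(a)‖ + ∫ₐᵗ N(s) e^{−P(s)} ds)`,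
  `P(t) = ∫ₐᵗ M`, no sign conditions; and (4.2) AS PRINTED for `M, N ≥ 0`:
  `norm_le_add_integral_mul_exp_integral` (forward: `‖g(t)‖ ≤ (‖g(a)‖ + ∫ₐᵗ N) exp ∫ₐᵗ M`) and
  `norm_le_add_abs_integral_mul_exp_abs_integral_uIcc` (two times in either order:
  `‖g(t)‖ ≤ (‖g(t₀)‖ + |∫_{t₀}^t N|) exp |∫_{t₀}^t M|`).

Mathlib has the constant-coefficient versions (`norm_le_gronwallBound_of_norm_deriv_right_le`,
`norm_image_sub_le_of_norm_deriv_le_segment'`); the tree's `LinearComparison.lean` has the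
variable-coefficient comparison for DIFFERENTIABLE scalar functions, `IntegralGronwall.lean` the
integral form, and `FluidPDE/ParticleTrajectoryFlowEstimates.lean` a measurability-free
lower-Lebesgue-integral Grönwall (`real_gronwall_Icc`) specialised to the particle-trajectory
equations in `B`. The norm `‖g‖` of a vector function is not differentiable, so the proof runs
Mathlib's fencing theorem `image_norm_le_of_norm_deriv_right_lt_deriv_boundary'` against the
majorants `(‖g(a)‖ + ε) exp (∫ₐᵗ M + ε (t − a))`, `ε → 0+` (Hartman's comparison argument), with
`M` continuous on `[a, b]` extended to `ℝ` by `Set.IccExtend` as in `LinearComparison.lean`.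
Theorems only; no definitions, no named facts.

## References

* [Hartman2002] P. Hartman, *Ordinary Differential Equations*, Classics in Applied Mathematics 38
  (SIAM 2002), Ch. IV §4, Lemma 4.1, eq. (4.2) (held text PDF p. 60); Ch. III Thm 1.1 (Grönwall).
-/

noncomputable section

open Set MeasureTheory intervalIntegral Filter Topology

namespace Literature.Analysis.ODE

section NormBound

variable {E : Type*} [NormedAddCommGroup E] [NormedSpace ℝ E]

/-- **Hartman's basic inequality (4.2), homogeneous case, forward.** Let `g` be continuous on
`[a, b]` with right derivative `g'(s)` at every `s ∈ [a, b)`, `M` continuous on `[a, b]`, and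
`‖g'(s)‖ ≤ M(s) ‖g(s)‖` on `[a, b)`. Then `‖g(t)‖ ≤ ‖g(a)‖ exp (∫ₐᵗ M)` for `t ∈ [a, b]`.
[cite: Hartman2002, Ch. IV Lemma 4.1 eq. (4.2) (PDF p. 60), case f ≡ 0, t₀ ≤ t] -/
theorem norm_le_mul_exp_integral_of_norm_deriv_right_le {g g' : ℝ → E} {M : ℝ → ℝ} {a b : ℝ}
    (hg : ContinuousOn g (Icc a b)) (hg' : ∀ s ∈ Ico a b, HasDerivWithinAt g (g' s) (Ici s) s)
    (hM : ContinuousOn M (Icc a b)) (bound : ∀ s ∈ Ico a b, ‖g' s‖ ≤ M s * ‖g s‖)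
    {t : ℝ} (ht : t ∈ Icc a b) : ‖g t‖ ≤ ‖g a‖ * Real.exp (∫ s in a..t, M s) := by
  have hab : a ≤ b := ht.1.trans ht.2
  set Mc : ℝ → ℝ := IccExtend hab ((Icc a b).restrict M) with hMc
  have hMcc : Continuous Mc := continuous_IccExtend_restrict hab hM
  set P : ℝ → ℝ := fun u => ∫ s in a..u, Mc s with hP
  have hPc : Continuous P := by
    simpa [hP] using (continuous_primitive hMcc.intervalIntegrable a)
  have hP' : ∀ u ∈ Ico a b, HasDerivWithinAt P (M u) (Ici u) u := fun u hu =>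
    hasDerivWithinAt_primitive hab hM hu
  -- fence with the majorants `(‖g a‖ + ε) exp (P + ε (· - a))`, `ε > 0`
  have key : ∀ ε : ℝ, 0 < ε → ‖g t‖ ≤ (‖g a‖ + ε) * Real.exp (P t + ε * (t - a)) := by
    intro ε hε
    set B : ℝ → ℝ := fun u => (‖g a‖ + ε) * Real.exp (P u + ε * (u - a)) with hB
    have hBc : ContinuousOn B (Icc a b) := by
      have : Continuous B := by simp only [hB]; fun_prop
      exact this.continuousOn
    have hB' : ∀ u ∈ Ico a b, HasDerivWithinAt B ((M u + ε) * B u) (Ici u) u := by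
      intro u hu
      have h1 : HasDerivWithinAt (fun u => P u + ε * (u - a)) (M u + ε * 1) (Ici u) u :=
        (hP' u hu).add (((hasDerivWithinAt_id u (Ici u)).sub_const a).const_mul ε)
      refine ((h1.exp).const_mul (‖g a‖ + ε)).congr_deriv ?_
      simp only [hB]; ring
    have ha : ‖g a‖ ≤ B a := by
      simp only [hB, hP, integral_same, sub_self, mul_zero, add_zero, Real.exp_zero, mul_one]
      exact le_add_of_nonneg_right hε.le
    have hbound : ∀ u ∈ Ico a b, ‖g u‖ = B u → ‖g' u‖ < (M u + ε) * B u := by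
      intro u hu hgu
      have hBpos : 0 < B u := mul_pos (by positivity) (Real.exp_pos _)
      calc ‖g' u‖ ≤ M u * ‖g u‖ := bound u hu
        _ = M u * B u := by rw [hgu]
        _ < (M u + ε) * B u := by nlinarith
    exact image_norm_le_of_norm_deriv_right_lt_deriv_boundary' hg hg' ha hBc hB' hbound ht
  -- let `ε → 0+`
  have hlim : Tendsto (fun ε : ℝ => (‖g a‖ + ε) * Real.exp (P t + ε * (t - a))) (𝓝[>] 0)
      (𝓝 (‖g a‖ * Real.exp (P t))) := by
    have hc : Continuous (fun ε : ℝ => (‖g a‖ + ε) * Real.exp (P t + ε * (t - a))) := by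
      fun_prop
    have h0 := hc.tendsto 0
    simp only [add_zero, zero_mul] at h0
    exact h0.mono_left nhdsWithin_le_nhds
  have hPt : P t = ∫ s in a..t, M s := primitive_IccExtend_eq hab ht
  rw [← hPt]
  exact ge_of_tendsto hlim (eventually_nhdsWithin_of_forall key)

/-- **Hartman's basic inequality (4.2), case `A ≡ 0`, forward.** Let `g` be continuous on
`[a, b]` with right derivative `g'(s)` at every `s ∈ [a, b)`, `N` continuous on `[a, b]`, and
`‖g'(s)‖ ≤ N(s)` on `[a, b)`. Then `‖g(t) − g(a)‖ ≤ ∫ₐᵗ N` for `t ∈ [a, b]`.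
[cite: Hartman2002, Ch. IV Lemma 4.1 eq. (4.2) (PDF p. 60), case A ≡ 0, t₀ ≤ t] -/
theorem norm_sub_le_integral_of_norm_deriv_right_le {g g' : ℝ → E} {N : ℝ → ℝ} {a b : ℝ}
    (hg : ContinuousOn g (Icc a b)) (hg' : ∀ s ∈ Ico a b, HasDerivWithinAt g (g' s) (Ici s) s)
    (hN : ContinuousOn N (Icc a b)) (bound : ∀ s ∈ Ico a b, ‖g' s‖ ≤ N s)
    {t : ℝ} (ht : t ∈ Icc a b) : ‖g t - g a‖ ≤ ∫ s in a..t, N s := by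
  have hab : a ≤ b := ht.1.trans ht.2
  set Nc : ℝ → ℝ := IccExtend hab ((Icc a b).restrict N) with hNc
  have hNcc : Continuous Nc := continuous_IccExtend_restrict hab hN
  set P : ℝ → ℝ := fun u => ∫ s in a..u, Nc s with hP
  have hPc : Continuous P := by
    simpa [hP] using (continuous_primitive hNcc.intervalIntegrable a)
  have hP' : ∀ u ∈ Ico a b, HasDerivWithinAt P (N u) (Ici u) u := fun u hu =>
    hasDerivWithinAt_primitive hab hN hu
  have h := image_norm_le_of_norm_deriv_right_le_deriv_boundary' (f := fun u => g u - g a)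
    (f' := g') (hg.sub continuousOn_const) (fun u hu => (hg' u hu).sub_const (g a))
    (B := P) (B' := N) (by simp [hP]) hPc.continuousOn hP' bound ht
  have hPt : P t = ∫ s in a..t, N s := primitive_IccExtend_eq hab ht
  simpa only [hPt] using h

/-- From derivatives within a closed interval at all of its points to the one-sided hypotheses of
the fencing theorems. [cite: Hartman2002, Ch. IV Lemma 4.1 (PDF p. 60), setting] -/
theorem hasDerivWithinAt_Ici_of_forall_Icc {g g' : ℝ → E} {a b : ℝ}
    (hg : ∀ s ∈ Icc a b, HasDerivWithinAt g (g' s) (Icc a b) s) :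
    ∀ s ∈ Ico a b, HasDerivWithinAt g (g' s) (Ici s) s := fun s hs =>
  (hg s (Ico_subset_Icc_self hs)).mono_of_mem_nhdsWithin
    (mem_of_superset (Icc_mem_nhdsGE hs.2) (Icc_subset_Icc hs.1 le_rfl))

/-- Time reversal: if `g` has derivative `g'(s)` within `[t, t₀]` at every point, then
`σ ↦ g(−σ)` has derivative `−g'(−σ)` within `[−t₀, −t]` at every point.
[cite: Hartman2002, Ch. IV Lemma 4.1 (PDF p. 60), proof ("interchanging t and t₀")] -/
theorem hasDerivWithinAt_comp_neg_of_forall_Icc {g g' : ℝ → E} {t₀ t : ℝ}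
    (hg : ∀ s ∈ Icc t t₀, HasDerivWithinAt g (g' s) (Icc t t₀) s) :
    ∀ σ ∈ Icc (-t₀) (-t), HasDerivWithinAt (fun σ => g (-σ)) (-(g' (-σ))) (Icc (-t₀) (-t)) σ := by
  have hmaps : MapsTo (fun σ : ℝ => -σ) (Icc (-t₀) (-t)) (Icc t t₀) := fun σ hσ =>
    ⟨by linarith [hσ.2], by linarith [hσ.1]⟩
  intro σ hσ
  simpa [Function.comp_def] using (hg (-σ) (hmaps hσ)).scomp σ
    ((hasDerivWithinAt_id σ _).neg) hmaps

/-- **Hartman's basic inequality (4.2), homogeneous case, between two times in either order.**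
If `g` has derivative `g'(s)` within the closed interval between `t₀` and `t` at each of its
points, `M` is continuous there and `‖g'(s)‖ ≤ M(s) ‖g(s)‖`, then
`‖g(t)‖ ≤ ‖g(t₀)‖ exp |∫_{t₀}^t M|`.
[cite: Hartman2002, Ch. IV Lemma 4.1 eq. (4.2) (PDF p. 60), case f ≡ 0] -/
theorem norm_le_mul_exp_abs_integral_of_norm_deriv_le_uIcc {g g' : ℝ → E} {M : ℝ → ℝ}
    {t₀ t : ℝ} (hg : ∀ s ∈ uIcc t₀ t, HasDerivWithinAt g (g' s) (uIcc t₀ t) s)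
    (hM : ContinuousOn M (uIcc t₀ t)) (bound : ∀ s ∈ uIcc t₀ t, ‖g' s‖ ≤ M s * ‖g s‖) :
    ‖g t‖ ≤ ‖g t₀‖ * Real.exp |∫ s in t₀..t, M s| := by
  have hexp : ∀ x : ℝ, Real.exp x ≤ Real.exp |x| := fun x => Real.exp_le_exp.2 (le_abs_self x)
  rcases le_total t₀ t with h | h
  · rw [uIcc_of_le h] at hg hM bound
    have key := norm_le_mul_exp_integral_of_norm_deriv_right_le
      (fun s hs => (hg s hs).continuousWithinAt) (hasDerivWithinAt_Ici_of_forall_Icc hg) hM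
      (fun s hs => bound s (Ico_subset_Icc_self hs)) (right_mem_Icc.2 h)
    exact key.trans (mul_le_mul_of_nonneg_left (hexp _) (norm_nonneg _))
  · rw [uIcc_of_ge h] at hg hM bound
    have hmaps : MapsTo (fun σ : ℝ => -σ) (Icc (-t₀) (-t)) (Icc t t₀) := fun σ hσ =>
      ⟨by linarith [hσ.2], by linarith [hσ.1]⟩
    have hder := hasDerivWithinAt_comp_neg_of_forall_Icc hg
    have key := norm_le_mul_exp_integral_of_norm_deriv_right_le (M := fun σ => M (-σ))
      (fun σ hσ => (hder σ hσ).continuousWithinAt) (hasDerivWithinAt_Ici_of_forall_Icc hder)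
      (hM.comp continuousOn_neg hmaps)
      (fun σ hσ => by simpa [norm_neg] using bound (-σ) (hmaps (Ico_subset_Icc_self hσ)))
      (right_mem_Icc.2 (neg_le_neg h))
    simp only [neg_neg] at key
    rw [intervalIntegral.integral_comp_neg, neg_neg, neg_neg] at key
    refine key.trans (mul_le_mul_of_nonneg_left ?_ (norm_nonneg _))
    rw [integral_symm]
    exact Real.exp_le_exp.2 (neg_le_abs _)

/-- **Hartman's basic inequality (4.2), case `A ≡ 0`, between two times in either order**:
`‖g(t) − g(t₀)‖ ≤ |∫_{t₀}^t N|` when `‖g'(s)‖ ≤ N(s)` on the closed interval between `t₀` and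
`t`, `N` continuous there. [cite: Hartman2002, Ch. IV Lemma 4.1 eq. (4.2) (PDF p. 60), case A ≡ 0] -/
theorem norm_sub_le_abs_integral_of_norm_deriv_le_uIcc {g g' : ℝ → E} {N : ℝ → ℝ}
    {t₀ t : ℝ} (hg : ∀ s ∈ uIcc t₀ t, HasDerivWithinAt g (g' s) (uIcc t₀ t) s)
    (hN : ContinuousOn N (uIcc t₀ t)) (bound : ∀ s ∈ uIcc t₀ t, ‖g' s‖ ≤ N s) :
    ‖g t - g t₀‖ ≤ |∫ s in t₀..t, N s| := by
  rcases le_total t₀ t with h | h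
  · rw [uIcc_of_le h] at hg hN bound
    have key := norm_sub_le_integral_of_norm_deriv_right_le
      (fun s hs => (hg s hs).continuousWithinAt) (hasDerivWithinAt_Ici_of_forall_Icc hg) hN
      (fun s hs => bound s (Ico_subset_Icc_self hs)) (right_mem_Icc.2 h)
    exact key.trans (le_abs_self _)
  · rw [uIcc_of_ge h] at hg hN bound
    have hmaps : MapsTo (fun σ : ℝ => -σ) (Icc (-t₀) (-t)) (Icc t t₀) := fun σ hσ =>
      ⟨by linarith [hσ.2], by linarith [hσ.1]⟩
    have hder := hasDerivWithinAt_comp_neg_of_forall_Icc hg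
    have key := norm_sub_le_integral_of_norm_deriv_right_le (N := fun σ => N (-σ))
      (fun σ hσ => (hder σ hσ).continuousWithinAt) (hasDerivWithinAt_Ici_of_forall_Icc hder)
      (hN.comp continuousOn_neg hmaps)
      (fun σ hσ => by simpa [norm_neg] using bound (-σ) (hmaps (Ico_subset_Icc_self hσ)))
      (right_mem_Icc.2 (neg_le_neg h))
    simp only [neg_neg] at key
    rw [intervalIntegral.integral_comp_neg, neg_neg, neg_neg] at key
    refine key.trans ?_
    rw [integral_symm]
    exact neg_le_abs _

/-! ## The general case `‖g'‖ ≤ M(s) ‖g‖ + N(s)` -/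

/-- **Hartman's basic inequality, general case, sharp form (the majorant solution `u⁰` of the
proof), forward.** Let `g` be continuous on `[a, b]` with right derivative `g'(s)` at every
`s ∈ [a, b)`, `M, N` continuous on `[a, b]`, and `‖g'(s)‖ ≤ M(s) ‖g(s)‖ + N(s)` on `[a, b)`.
Then `‖g(t)‖ ≤ e^{P(t)} (‖g(a)‖ + ∫ₐᵗ N(s) e^{−P(s)} ds)` for `t ∈ [a, b]`, where `P(t) = ∫ₐᵗ M`
(no sign condition on `M`, `N`). [cite: Hartman2002, Ch. IV Lemma 4.1, proof (u⁰(t) display) (PDF p. 60)] -/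
theorem norm_le_exp_integral_mul_of_norm_deriv_right_le {g g' : ℝ → E} {M N : ℝ → ℝ} {a b : ℝ}
    (hg : ContinuousOn g (Icc a b)) (hg' : ∀ s ∈ Ico a b, HasDerivWithinAt g (g' s) (Ici s) s)
    (hM : ContinuousOn M (Icc a b)) (hN : ContinuousOn N (Icc a b))
    (bound : ∀ s ∈ Ico a b, ‖g' s‖ ≤ M s * ‖g s‖ + N s) {t : ℝ} (ht : t ∈ Icc a b) :
    ‖g t‖ ≤ Real.exp (∫ s in a..t, M s) *
      (‖g a‖ + ∫ s in a..t, N s * Real.exp (-(∫ u in a..s, M u))) := by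
  have hab : a ≤ b := ht.1.trans ht.2
  set Mc : ℝ → ℝ := IccExtend hab ((Icc a b).restrict M) with hMc
  set Nc : ℝ → ℝ := IccExtend hab ((Icc a b).restrict N) with hNc
  have hMcc : Continuous Mc := continuous_IccExtend_restrict hab hM
  have hNcc : Continuous Nc := continuous_IccExtend_restrict hab hN
  set P : ℝ → ℝ := fun u => ∫ s in a..u, Mc s with hP
  have hPc : Continuous P := by
    simpa [hP] using (continuous_primitive hMcc.intervalIntegrable a)
  have hP' : ∀ u ∈ Ico a b, HasDerivWithinAt P (M u) (Ici u) u := fun u hu =>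
    hasDerivWithinAt_primitive hab hM hu
  -- `Q = ∫ N e^{-P}`, `R = ∫ e^{-P}`
  have hqc : Continuous fun s => Nc s * Real.exp (-P s) := hNcc.mul hPc.neg.rexp
  have hrc : Continuous fun s => Real.exp (-P s) := hPc.neg.rexp
  set Q : ℝ → ℝ := fun u => ∫ s in a..u, Nc s * Real.exp (-P s) with hQ
  set R : ℝ → ℝ := fun u => ∫ s in a..u, Real.exp (-P s) with hR
  have hQc : Continuous Q := by
    simpa [hQ] using (continuous_primitive hqc.intervalIntegrable a)
  have hRc : Continuous R := by
    simpa [hR] using (continuous_primitive hrc.intervalIntegrable a)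
  have hQ' : ∀ u ∈ Ico a b, HasDerivWithinAt Q (N u * Real.exp (-P u)) (Ici u) u := by
    intro u hu
    have h := (integral_hasStrictDerivAt_right (hqc.intervalIntegrable a u)
      (hqc.stronglyMeasurableAtFilter volume (𝓝 u)) hqc.continuousAt).hasDerivAt.hasDerivWithinAt
      (s := Ici u)
    have hNu : Nc u = N u := IccExtend_restrict_of_mem hab (Ico_subset_Icc_self hu)
    simpa [hQ, hNu] using h
  have hR' : ∀ u, HasDerivAt R (Real.exp (-P u)) u := fun u =>
    (integral_hasStrictDerivAt_right (hrc.intervalIntegrable a u)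
      (hrc.stronglyMeasurableAtFilter volume (𝓝 u)) hrc.continuousAt).hasDerivAt
  -- fence with `B_ε = e^{P} (‖g a‖ + ε + Q + ε R)`, the solution of `u' = M u + N + ε`
  have key : ∀ ε : ℝ, 0 < ε →
      ‖g t‖ ≤ Real.exp (P t) * (‖g a‖ + ε + Q t + ε * R t) := by
    intro ε hε
    set B : ℝ → ℝ := fun u => Real.exp (P u) * (‖g a‖ + ε + Q u + ε * R u) with hB
    have hBc : ContinuousOn B (Icc a b) := by
      have : Continuous B := by simp only [hB]; fun_prop
      exact this.continuousOn
    have hB' : ∀ u ∈ Ico a b, HasDerivWithinAt B (M u * B u + (N u + ε)) (Ici u) u := by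
      intro u hu
      have hR'' : HasDerivWithinAt (fun y => ε * R y) (ε * Real.exp (-P u)) (Ici u) u :=
        ((hR' u).hasDerivWithinAt).const_mul ε
      have h1 : HasDerivWithinAt (fun u => ‖g a‖ + ε + Q u + ε * R u)
          (N u * Real.exp (-P u) + ε * Real.exp (-P u)) (Ici u) u :=
        ((hQ' u hu).const_add (‖g a‖ + ε)).add hR''
      have h2 := ((hP' u hu).exp).mul h1
      refine h2.congr_deriv ?_
      have hEE : Real.exp (P u) * Real.exp (-P u) = 1 := by
        rw [← Real.exp_add, add_neg_cancel, Real.exp_zero]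
      simp only [hB]
      have : Real.exp (P u) * (N u * Real.exp (-P u) + ε * Real.exp (-P u)) = N u + ε := by
        calc Real.exp (P u) * (N u * Real.exp (-P u) + ε * Real.exp (-P u))
            = (N u + ε) * (Real.exp (P u) * Real.exp (-P u)) := by ring
          _ = N u + ε := by rw [hEE, mul_one]
      rw [this]; ring
    have ha : ‖g a‖ ≤ B a := by
      simp only [hB, hP, hQ, hR, integral_same, Real.exp_zero, one_mul, add_zero, mul_zero]
      exact le_add_of_nonneg_right hε.le
    have hbound : ∀ u ∈ Ico a b, ‖g u‖ = B u → ‖g' u‖ < M u * B u + (N u + ε) := by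
      intro u hu hgu
      calc ‖g' u‖ ≤ M u * ‖g u‖ + N u := bound u hu
        _ = M u * B u + N u := by rw [hgu]
        _ < M u * B u + (N u + ε) := by linarith
    exact image_norm_le_of_norm_deriv_right_lt_deriv_boundary' hg hg' ha hBc hB' hbound ht
  -- let `ε → 0+`
  have hlim : Tendsto (fun ε : ℝ => Real.exp (P t) * (‖g a‖ + ε + Q t + ε * R t)) (𝓝[>] 0)
      (𝓝 (Real.exp (P t) * (‖g a‖ + Q t))) := by
    have hc : Continuous (fun ε : ℝ => Real.exp (P t) * (‖g a‖ + ε + Q t + ε * R t)) := by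
      fun_prop
    have h0 := hc.tendsto 0
    simp only [add_zero, zero_mul] at h0
    exact h0.mono_left nhdsWithin_le_nhds
  have hle : ‖g t‖ ≤ Real.exp (P t) * (‖g a‖ + Q t) :=
    ge_of_tendsto hlim (eventually_nhdsWithin_of_forall key)
  -- unpack the clamped coefficients on `[a, t]`
  have hPt : P t = ∫ s in a..t, M s := primitive_IccExtend_eq hab ht
  have hQt : Q t = ∫ s in a..t, N s * Real.exp (-(∫ u in a..s, M u)) := by
    apply integral_congr
    intro s hs
    rw [uIcc_of_le ht.1] at hs
    have hs' : s ∈ Icc a b := ⟨hs.1, hs.2.trans ht.2⟩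
    simp only [hNc, hP]
    rw [IccExtend_restrict_of_mem hab hs', primitive_IccExtend_eq hab hs']
  rw [← hPt, ← hQt]
  exact hle

/-- **Hartman's basic inequality (4.2) as printed, forward**: if `‖g'(s)‖ ≤ M(s) ‖g(s)‖ + N(s)`
on `[a, b)` with `M, N ≥ 0` continuous on `[a, b]` (`M = ‖A(·)‖`, `N = |f(·)|` in Hartman),
then `‖g(t)‖ ≤ (‖g(a)‖ + ∫ₐᵗ N) exp (∫ₐᵗ M)` for `t ∈ [a, b]`.
[cite: Hartman2002, Ch. IV Lemma 4.1 eq. (4.2) (PDF p. 60), t₀ ≤ t] -/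
theorem norm_le_add_integral_mul_exp_integral {g g' : ℝ → E} {M N : ℝ → ℝ} {a b : ℝ}
    (hg : ContinuousOn g (Icc a b)) (hg' : ∀ s ∈ Ico a b, HasDerivWithinAt g (g' s) (Ici s) s)
    (hM : ContinuousOn M (Icc a b)) (hN : ContinuousOn N (Icc a b))
    (hM0 : ∀ s ∈ Icc a b, 0 ≤ M s) (hN0 : ∀ s ∈ Icc a b, 0 ≤ N s)
    (bound : ∀ s ∈ Ico a b, ‖g' s‖ ≤ M s * ‖g s‖ + N s) {t : ℝ} (ht : t ∈ Icc a b) :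
    ‖g t‖ ≤ (‖g a‖ + ∫ s in a..t, N s) * Real.exp (∫ s in a..t, M s) := by
  have h := norm_le_exp_integral_mul_of_norm_deriv_right_le hg hg' hM hN bound ht
  rw [mul_comm] at h
  refine h.trans (mul_le_mul_of_nonneg_right ?_ (Real.exp_pos _).le)
  gcongr ‖g a‖ + ?_
  have hMi : IntervalIntegrable M volume a t :=
    (hM.mono (Icc_subset_Icc_right ht.2)).intervalIntegrable_of_Icc ht.1
  have hNc' : ContinuousOn N (Icc a t) := hN.mono (Icc_subset_Icc_right ht.2)
  have hPc' : ContinuousOn (fun s => ∫ u in a..s, M u) (Icc a t) := by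
    have := continuousOn_primitive_interval' hMi left_mem_uIcc
    rwa [uIcc_of_le ht.1] at this
  refine integral_mono_on ht.1 ((hNc'.mul hPc'.neg.rexp).intervalIntegrable_of_Icc ht.1)
    (hNc'.intervalIntegrable_of_Icc ht.1) fun s hs => ?_
  have hP0 : 0 ≤ ∫ u in a..s, M u :=
    integral_nonneg hs.1 fun u hu => hM0 u ⟨hu.1, hu.2.trans (hs.2.trans ht.2)⟩
  have hexp : Real.exp (-(∫ u in a..s, M u)) ≤ 1 := by
    rw [Real.exp_le_one_iff]; linarith
  exact mul_le_of_le_one_right (hN0 s ⟨hs.1, hs.2.trans ht.2⟩) hexp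

/-- **Hartman's basic inequality (4.2) as printed, between two times in either order**: if `g`
has derivative `g'(s)` within the closed interval between `t₀` and `t` at each of its points,
`M, N ≥ 0` are continuous there and `‖g'(s)‖ ≤ M(s) ‖g(s)‖ + N(s)`, then
`‖g(t)‖ ≤ (‖g(t₀)‖ + |∫_{t₀}^t N|) exp |∫_{t₀}^t M|` ("interchanging `t` and `t₀` … gives (4.2)
for `t ≤ t₀`"). [cite: Hartman2002, Ch. IV Lemma 4.1 eq. (4.2) (PDF p. 60)] -/
theorem norm_le_add_abs_integral_mul_exp_abs_integral_uIcc {g g' : ℝ → E} {M N : ℝ → ℝ}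
    {t₀ t : ℝ} (hg : ∀ s ∈ uIcc t₀ t, HasDerivWithinAt g (g' s) (uIcc t₀ t) s)
    (hM : ContinuousOn M (uIcc t₀ t)) (hN : ContinuousOn N (uIcc t₀ t))
    (hM0 : ∀ s ∈ uIcc t₀ t, 0 ≤ M s) (hN0 : ∀ s ∈ uIcc t₀ t, 0 ≤ N s)
    (bound : ∀ s ∈ uIcc t₀ t, ‖g' s‖ ≤ M s * ‖g s‖ + N s) :
    ‖g t‖ ≤ (‖g t₀‖ + |∫ s in t₀..t, N s|) * Real.exp |∫ s in t₀..t, M s| := by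
  have hfin : ∀ {I J : ℝ}, ‖g t‖ ≤ (‖g t₀‖ + I) * Real.exp J → 0 ≤ I →
      I ≤ |∫ s in t₀..t, N s| → J ≤ |∫ s in t₀..t, M s| →
      ‖g t‖ ≤ (‖g t₀‖ + |∫ s in t₀..t, N s|) * Real.exp |∫ s in t₀..t, M s| :=
    fun h hI hI' hJ' => h.trans (mul_le_mul (by linarith) (Real.exp_le_exp.2 hJ')
      (Real.exp_pos _).le (by positivity))
  rcases le_total t₀ t with h | h
  · rw [uIcc_of_le h] at hg hM hN hM0 hN0 bound
    have key := norm_le_add_integral_mul_exp_integral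
      (fun s hs => (hg s hs).continuousWithinAt) (hasDerivWithinAt_Ici_of_forall_Icc hg) hM hN
      hM0 hN0 (fun s hs => bound s (Ico_subset_Icc_self hs)) (right_mem_Icc.2 h)
    exact hfin key (integral_nonneg h hN0) (le_abs_self _) (le_abs_self _)
  · rw [uIcc_of_ge h] at hg hM hN hM0 hN0 bound
    have hmaps : MapsTo (fun σ : ℝ => -σ) (Icc (-t₀) (-t)) (Icc t t₀) := fun σ hσ =>
      ⟨by linarith [hσ.2], by linarith [hσ.1]⟩
    have hder := hasDerivWithinAt_comp_neg_of_forall_Icc hg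
    have key := norm_le_add_integral_mul_exp_integral (M := fun σ => M (-σ))
      (N := fun σ => N (-σ)) (fun σ hσ => (hder σ hσ).continuousWithinAt)
      (hasDerivWithinAt_Ici_of_forall_Icc hder) (hM.comp continuousOn_neg hmaps)
      (hN.comp continuousOn_neg hmaps) (fun σ hσ => hM0 _ (hmaps hσ))
      (fun σ hσ => hN0 _ (hmaps hσ))
      (fun σ hσ => by simpa [norm_neg] using bound (-σ) (hmaps (Ico_subset_Icc_self hσ)))
      (right_mem_Icc.2 (neg_le_neg h))
    simp only [neg_neg] at key
    rw [intervalIntegral.integral_comp_neg, intervalIntegral.integral_comp_neg, neg_neg,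
      neg_neg] at key
    refine hfin key (integral_nonneg h hN0) ?_ ?_
    · rw [integral_symm]; exact neg_le_abs _
    · rw [integral_symm]; exact neg_le_abs _

end NormBound

end Literature.Analysis.ODE

end
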